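import Summits.ABC.IUTFork.Cor312RegimeVerbatimPrVolExactCriterion
import Summits.ABC.IUTFork.Cor312HullGainRamifiedAllLabels
import Summits.ABC.IUTFork.Cor312HullGainDyadic
import HarnessLib

/-!
# [IUTchIII] Cor. 3.12 — the regime decomposition at the print-normalised sharp setting of record, VI: `−|log(Θ)|(𝟙) > 0`
# with NO label bound and NO hypothesis on `S` — every base field of genuine Θ-data

PROOF-ONLY support piece of the abc-iut cell (Cor. 3.12 cone, D-0067; seat abc-iut-w4-d107, gen 5; part 18 of the
`Cor312NegLogThetaUpperPrVol*` / `Cor312RegimeVerbatimPrVol*` chain; strengthens part 13 `Cor312RegimeVerbatimPrVolExactRamified`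
using abc-iut-c312-5's ALL-LABELS ramified gain `Cor312HullGainRamifiedAllLabels` (p443796) in place of the label-bounded
`thetaLocal_settingPrVolSharp_pos_of_ramified`). TAKES NO SIDE on [IUTchIII] Cor. 3.12; theorems only, 0 `def`s, no new
`Prop` fact, no instance.

* `negLogTheta_settingPrVolSharp_trivial_nonneg'` — `0 ≤ −|log(Θ)|(𝟙)` for EVERY pilot datum (no hypothesis on `S`: every
  local term of the trivial configuration is `≥ 0`, box ≤ hull with unit boxes);
* `thetaLocal_settingPrVolSharp_trivial_pos_of_two_le_ramificationIdx` — at EVERY label `i+1` and every prime `p` under a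
  place `v` of `F` with `e_v ≥ 2`: `0 < −|log(Θ)|_{i+1,p}(𝟙)` (the (Ind3)-region of `𝟙` has log-volume `0`, and c312-5's
  region < hull is strict at every label);
* **`negLogTheta_settingPrVolSharp_trivial_pos_of_two_le_ramificationIdx`** — hence `0 < −|log(Θ)|(𝟙)` as soon as `F` has
  ONE place of ramification index `≥ 2` (no hypothesis on `S`, no label bound);
* **`negLogTheta_settingPrVolSharp_trivial_pos_of_sq_eq_neg_one'`** — in particular for EVERY base field of genuine Θ-data
  (`√−1 ∈ F`, [IUTchI] Def. 3.1 (a): every `v | 2` has `e_v ≥ 2`, campaign-S / c312-5 `Cor312HullGainDyadic`);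
* `settingPrVolSharp_regime_exact_pos_of_two_le_ramificationIdx` — the exact criterion of part 12 with a REAL shift
  `κ = −|log(Θ)|(𝟙) > 0` under that single ramification hypothesis: `Statement(t_q, t) ⟺ Qside − Θside ≤ κ` for all pilot
  ideles whose bad places lie over a finite set of odd primes unramified in `F`.
HONEST SCOPE as in parts 7–17: (Ind2) as typed at the real setting (`Real.ismDH`); sharp (Ind3) reading; trivial
archimedean container; free ideles; the positive instances are inflation-dominated and say nothing about print's intended
content; nothing here asserts or denies [IUTchIII] Cor. 3.12 for initial Θ-data. typed ≠ proved; instantiated ≠ endorsed.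
[claim: Mochizuki2012, status: disputed] [cite: Mochizuki2012, IUTchI Def. 3.1 (a) p. 61]
[cite: DupuyHilado2025, §3.6, §3.9, §4.7, §4.9]
-/

noncomputable section

open Set Function NumberField IsDedekindDomain
open scoped Pointwise

namespace Summit.ABC

namespace IUTFork

namespace Thm311

namespace Real

open Cor312 Cor312.Setting Cor312Vol Literature.IUT.LogThetaLattice Literature.IUT.LogVolume
  Literature.NumberTheory.NumberFields

variable {F : Type} [Field F] [NumberField F] (X : PilotData F) {logv : PadicLogs F} (hlog : LogvAnalytic logv)

section Positive

variable (M : Type) [Field M] [NumberField M]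
  (archPk : ∀ (j : (thetaIndex X).Label) (vQ : (thetaIndex X).VQ), Set ((logShellsDH X logv).Packet j vQ))
  (archSub : ∀ (j : (thetaIndex X).Label) (v : (thetaIndex X).V),
    Set ((logShellsDH X logv).Packet j ((thetaIndex X).over v)))
  (Ψ : ℤ → ∀ v : (thetaIndex X).V, v ∈ (thetaIndex X).Vbad → Set ((logShellsDH X logv).StarPacket v))
  (act : ℤ → ∀ v : (thetaIndex X).V, v ∈ (thetaIndex X).Vbad →
    (logShellsDH X logv).StarPacket v → Module.End ℚ ((logShellsDH X logv).StarPacket v))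
  (Mmod : ℤ → ∀ j : (thetaIndex X).LabelStar, Set ((logShellsDH X logv).GlobalPacket j.1))
  (region : ℤ → ∀ j : (thetaIndex X).LabelStar, FinDivisor M → ∀ vQ : (thetaIndex X).VQ,
    Set ((logShellsDH X logv).Packet j.1 vQ))
  (n : ℤ) {HT : Type} {LogLink : HT → HT → Type} {IsFull : ∀ {s t : HT}, LogLink s t → Prop}
  (lat : LGPGaussianLogThetaLattice LogLink IsFull)
  {Frd : Type} {IsoF : Frd → Frd → Type} {Ob : Frd → Type} {realify : Frd → Frd} {Strip : Type}
  {IsoS : Strip → Strip → Type} {Mv : ∀ v : (thetaIndex X).V, v ∈ (thetaIndex X).Vbad → Type}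
  [∀ v h, Monoid (Mv v h)]
  (sig : GlobalLGPFrobenioidSignature (thetaIndex X).lstar (thetaIndex X).V (· ∈ (thetaIndex X).Vbad)
    Frd IsoF Ob realify Strip IsoS Mv)
  (split : SplittingMonoids Mv) {ObΔ : Type} {N : ∀ v : (thetaIndex X).V, v ∈ (thetaIndex X).Vbad → Type}
  [∀ v h, Monoid (N v h)] (qData : QPilotData ObΔ N)

/-! ## §1. `0 ≤ −|log(Θ)|(𝟙)` for every pilot datum -/

/-- **`0 ≤ −|log(Θ)|(𝟙)` with NO hypothesis on `S`**: every local term of the trivial configuration is `≥ 0` (box ≤ hull,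
part 7's `sum_weightPr_log_le_thetaLocal_untopD_settingPrVolSharp` with unit boxes; `0` at `∞`), hence so are their finite
sums and the procession normalisation. [cite: DupuyHilado2025, §3.9] -/
theorem negLogTheta_settingPrVolSharp_trivial_nonneg' :
    (0 : WithTop ℝ) ≤
      (settingPrVolSharp X hlog M archPk archSub Ψ act Mmod region n lat sig split qData (fun _ _ => 1) (fun _ _ _ => 1)
        (fun _ _ => one_ne_zero) (fun _ _ _ => norm_one)).negLogTheta := by
  have hfinΘ₁ := thetaFinite_settingPrVolSharp X hlog M archPk archSub Ψ act Mmod region n lat sig split qData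
    (fun _ _ _ => 1) (fun _ _ => 1) (fun _ _ _ => one_ne_zero) (fun _ _ _ _ => norm_one) (fun _ _ => one_ne_zero)
    (fun _ _ _ => norm_one)
  have H₁ := bridgeHyps_settingPrVolSharp_of_ideles X hlog M archPk archSub Ψ act Mmod region n lat sig split qData
    (fun _ _ _ => 1) (fun _ _ => 1) (fun _ _ _ => one_ne_zero) (fun _ _ _ _ => norm_one) (fun _ _ => one_ne_zero)
    (fun _ _ _ => norm_one)
  have hnn : ∀ (i : Fin (thetaIndex X).lstar) (vQ : (thetaIndex X).VQ),
      0 ≤ ((settingPrVolSharp X hlog M archPk archSub Ψ act Mmod region n lat sig split qData (fun _ _ => 1)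
        (fun _ _ _ => 1) (fun _ _ => one_ne_zero) (fun _ _ _ => norm_one)).thetaLocal (Setting.labelSucc i) vQ).untopD 0 := by
    intro i vQ
    rcases vQ with u | pp
    · exact (thetaLocal_settingPrVol_untopD_inl X hlog M archPk archSub Ψ act Mmod region n lat sig split qData _ _ _ _ u i
        H₁).ge
    · haveI : Fact (pp : ℕ).Prime := ⟨pp.2⟩
      refine le_trans (le_of_eq ?_) (sum_weightPr_log_le_thetaLocal_untopD_settingPrVolSharp X hlog M archPk archSub Ψ act
        Mmod region n lat sig split qData (fun _ _ _ => 1) (fun _ _ => 1) (fun _ _ _ => one_ne_zero)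
        (fun _ _ _ _ => norm_one) (fun _ _ => one_ne_zero) (fun _ _ _ => norm_one) i pp)
      refine (Finset.sum_eq_zero fun e _ => ?_).symm
      rw [norm_one, Real.log_one, mul_zero]
  unfold Setting.negLogTheta
  rw [if_pos hfinΘ₁]
  refine WithTop.coe_nonneg.mpr ?_
  unfold processionNormalized
  exact div_nonneg (Finset.sum_nonneg fun i _ => finsum_nonneg (hnn i)) (Nat.cast_nonneg _)

/-! ## §2. `0 < −|log(Θ)|(𝟙)` at EVERY label over a ramified place, no hypothesis on `S` -/

/-- **At EVERY label `i+1` and every prime `p` under a place `v` of `F` with `e_v ≥ 2`, the local Θ-term of the trivial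
configuration is STRICTLY POSITIVE**: the (Ind3)-region of `𝟙` at `(i+1, p)` (the unit box) has log-volume `0`
(abc-iut-c312-7 `logvol_thetaRegion3_sharp_Pr_inr`) and abc-iut-c312-5's region < hull is strict at every label
(`logvol_thetaRegion3_lt_thetaLocal_settingPrVolSharp_of_two_le_ramificationIdx`, p443796). No hypothesis on `S`, no label
bound. [cite: DupuyHilado2025, §3.9, §4.9] [claim: Mochizuki2012, status: disputed] -/
theorem thetaLocal_settingPrVolSharp_trivial_pos_of_two_le_ramificationIdx (i : Fin (thetaIndex X).lstar) (pp : Nat.Primes)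
    (v : HeightOneSpectrum (𝓞 F)) (hv : (thetaIndex X).over (.inr v) = .inr pp) (hvp : ((pp : ℕ) : 𝓞 F) ∈ v.asIdeal)
    (he : haveI : Fact (pp : ℕ).Prime := ⟨pp.2⟩; 2 ≤ absRamificationIdx (pp : ℕ) (RescaledCompletion F (pp : ℕ) v hvp)) :
    (0 : WithTop ℝ) <
      (settingPrVolSharp X hlog M archPk archSub Ψ act Mmod region n lat sig split qData (fun _ _ => 1) (fun _ _ _ => 1)
        (fun _ _ => one_ne_zero) (fun _ _ _ => norm_one)).thetaLocal (Setting.labelSucc i) (.inr pp) := by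
  haveI : Fact (pp : ℕ).Prime := ⟨pp.2⟩
  have hlt := logvol_thetaRegion3_lt_thetaLocal_settingPrVolSharp_of_two_le_ramificationIdx X hlog M archPk archSub Ψ act
    Mmod region n (fun _ _ _ => 1) (fun _ _ => 1) lat sig split qData (fun _ _ _ => one_ne_zero) (fun _ _ _ _ => norm_one)
    (fun _ _ => one_ne_zero) (fun _ _ _ => norm_one) i pp v hv hvp he
  have hval : ((situationPrVol X hlog M archPk archSub Ψ act Mmod region).D n).logvol (Setting.labelSucc i) (.inr pp)
      ((settingPrVolSharp X hlog M archPk archSub Ψ act Mmod region n lat sig split qData (fun _ _ => 1) (fun _ _ _ => 1)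
        (fun _ _ => one_ne_zero) (fun _ _ _ => norm_one)).thetaRegion3 (Setting.labelSucc i) (.inr pp)) =
      ∑ e : (presAt X hlog pp).toLocalPieces.E (Setting.labelSucc i),
        weightPr X pp.1 (Setting.labelSucc i) e *
          Real.log ‖(fun (_ : Nat.Primes) (_ : Fin X.lstar) (x : (thetaIndex X).Fibre (.inr pp)) =>
            (1 : kOf X pp.1 x)) pp i (e (Fin.last _))‖ :=
    logvol_thetaRegion3_sharp_Pr_inr X hlog M archPk archSub Ψ act Mmod region n lat sig split qData
      (fun _ => qCentreDH X hlog (fun _ _ => 1)) (qCentreDH_ne_zero X hlog (fun _ _ => 1) (fun _ _ => one_ne_zero))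
      (finite_support_logvol_qRegion_Pr X hlog M archPk archSub Ψ act Mmod region n (fun _ _ => 1) (fun _ _ => one_ne_zero)
        (fun _ _ _ => norm_one)) (fun _ _ _ => 1) (fun _ _ _ => one_ne_zero) i pp
  have h0 : ∑ e : (presAt X hlog pp).toLocalPieces.E (Setting.labelSucc i),
        weightPr X pp.1 (Setting.labelSucc i) e *
          Real.log ‖(fun (_ : Nat.Primes) (_ : Fin X.lstar) (x : (thetaIndex X).Fibre (.inr pp)) =>
            (1 : kOf X pp.1 x)) pp i (e (Fin.last _))‖ = 0 :=
    Finset.sum_eq_zero fun e _ => by rw [norm_one, Real.log_one, mul_zero]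
  rw [hval, h0, WithTop.coe_zero] at hlt
  exact hlt

/-- **`−|log(Θ)|(𝟙) > 0` AS SOON AS `F` HAS ONE PLACE OF RAMIFICATION INDEX `≥ 2`** — no hypothesis on `S`, no label bound:
every local term of the trivial configuration is `≥ 0` (§1) and the ones over the ramified prime are `> 0` (§2).
[cite: DupuyHilado2025, §3.9, §4.9] [claim: Mochizuki2012, status: disputed] -/
theorem negLogTheta_settingPrVolSharp_trivial_pos_of_two_le_ramificationIdx (pp : Nat.Primes)
    (v : HeightOneSpectrum (𝓞 F)) (hv : (thetaIndex X).over (.inr v) = .inr pp) (hvp : ((pp : ℕ) : 𝓞 F) ∈ v.asIdeal)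
    (he : haveI : Fact (pp : ℕ).Prime := ⟨pp.2⟩; 2 ≤ absRamificationIdx (pp : ℕ) (RescaledCompletion F (pp : ℕ) v hvp)) :
    (0 : WithTop ℝ) <
      (settingPrVolSharp X hlog M archPk archSub Ψ act Mmod region n lat sig split qData (fun _ _ => 1) (fun _ _ _ => 1)
        (fun _ _ => one_ne_zero) (fun _ _ _ => norm_one)).negLogTheta := by
  haveI : Fact (pp : ℕ).Prime := ⟨pp.2⟩
  have hfinΘ₁ := thetaFinite_settingPrVolSharp X hlog M archPk archSub Ψ act Mmod region n lat sig split qData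
    (fun _ _ _ => 1) (fun _ _ => 1) (fun _ _ _ => one_ne_zero) (fun _ _ _ _ => norm_one) (fun _ _ => one_ne_zero)
    (fun _ _ _ => norm_one)
  have H₁ := bridgeHyps_settingPrVolSharp_of_ideles X hlog M archPk archSub Ψ act Mmod region n lat sig split qData
    (fun _ _ _ => 1) (fun _ _ => 1) (fun _ _ _ => one_ne_zero) (fun _ _ _ _ => norm_one) (fun _ _ => one_ne_zero)
    (fun _ _ _ => norm_one)
  have hnn : ∀ (i : Fin (thetaIndex X).lstar) (vQ : (thetaIndex X).VQ),
      0 ≤ ((settingPrVolSharp X hlog M archPk archSub Ψ act Mmod region n lat sig split qData (fun _ _ => 1)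
        (fun _ _ _ => 1) (fun _ _ => one_ne_zero) (fun _ _ _ => norm_one)).thetaLocal (Setting.labelSucc i) vQ).untopD 0 := by
    intro i vQ
    rcases vQ with u | pp'
    · exact (thetaLocal_settingPrVol_untopD_inl X hlog M archPk archSub Ψ act Mmod region n lat sig split qData _ _ _ _ u i
        H₁).ge
    · haveI : Fact (pp' : ℕ).Prime := ⟨pp'.2⟩
      refine le_trans (le_of_eq ?_) (sum_weightPr_log_le_thetaLocal_untopD_settingPrVolSharp X hlog M archPk archSub Ψ act
        Mmod region n lat sig split qData (fun _ _ _ => 1) (fun _ _ => 1) (fun _ _ _ => one_ne_zero)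
        (fun _ _ _ _ => norm_one) (fun _ _ => one_ne_zero) (fun _ _ _ => norm_one) i pp')
      refine (Finset.sum_eq_zero fun e _ => ?_).symm
      rw [norm_one, Real.log_one, mul_zero]
  -- one label suffices; take `i₀ := 0`
  have hl : 0 < (thetaIndex X).lstar := lt_of_lt_of_le two_pos (thetaIndex X).two_le_lstar
  set i₀ : Fin (thetaIndex X).lstar := ⟨0, hl⟩ with hi₀
  have hloc := thetaLocal_settingPrVolSharp_trivial_pos_of_two_le_ramificationIdx X hlog M archPk archSub Ψ act Mmod region n
    lat sig split qData i₀ pp v hv hvp he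
  have hpos : 0 < ((settingPrVolSharp X hlog M archPk archSub Ψ act Mmod region n lat sig split qData (fun _ _ => 1)
      (fun _ _ _ => 1) (fun _ _ => one_ne_zero) (fun _ _ _ => norm_one)).thetaLocal (Setting.labelSucc i₀)
        (.inr pp)).untopD 0 := by
    obtain ⟨r, hr⟩ := WithTop.ne_top_iff_exists.mp (hfinΘ₁.1 i₀ (.inr pp))
    rw [← hr] at hloc
    rw [← hr, WithTop.untopD_coe]
    exact WithTop.coe_pos.mp hloc
  unfold Setting.negLogTheta
  rw [if_pos hfinΘ₁]
  refine WithTop.coe_pos.mpr ?_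
  have hlt : (0 : ℝ) < ∑ᶠ vQ : (thetaIndex X).VQ,
      ((settingPrVolSharp X hlog M archPk archSub Ψ act Mmod region n lat sig split qData (fun _ _ => 1) (fun _ _ _ => 1)
        (fun _ _ => one_ne_zero) (fun _ _ _ => norm_one)).thetaLocal (Setting.labelSucc i₀) vQ).untopD 0 :=
    hpos.trans_le (single_le_finsum (Sum.inr pp) (hfinΘ₁.2 i₀) (hnn i₀))
  have h0 : processionNormalized (fun _ : Fin (thetaIndex X).lstar => (0 : ℝ)) = 0 := by
    unfold processionNormalized; rw [Finset.sum_const_zero, zero_div]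
  have h := processionNormalized_lt_of_le_of_lt hl (f := fun _ : Fin (thetaIndex X).lstar => (0 : ℝ))
    (fun i' => finsum_nonneg (hnn i')) hlt
  rwa [h0] at h

/-- **`−|log(Θ)|(𝟙) > 0` FOR EVERY BASE FIELD OF GENUINE Θ-DATA** — no hypothesis on `S`, no label bound: `√−1 ∈ F`
([IUTchI] Def. 3.1 (a)) forces `e_v ≥ 2` at every place `v | 2` (campaign-S `two_le_absRamificationIdx_two_of_sq_eq_neg_one`,
read in the rescaled completion by abc-iut-c312-5's `Cor312HullGainDyadic`). [cite: Mochizuki2012, IUTchI Def. 3.1 (a) p. 61]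
[cite: DupuyHilado2025, §3.9, §4.9] [claim: Mochizuki2012, status: disputed] -/
theorem negLogTheta_settingPrVolSharp_trivial_pos_of_sq_eq_neg_one' (r : F) (hr : r ^ 2 = -1)
    (v : HeightOneSpectrum (𝓞 F)) (hv : (thetaIndex X).over (.inr v) = .inr ⟨2, Nat.prime_two⟩)
    (hvp : ((2 : ℕ) : 𝓞 F) ∈ v.asIdeal) :
    (0 : WithTop ℝ) <
      (settingPrVolSharp X hlog M archPk archSub Ψ act Mmod region n lat sig split qData (fun _ _ => 1) (fun _ _ _ => 1)
        (fun _ _ => one_ne_zero) (fun _ _ _ => norm_one)).negLogTheta :=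
  negLogTheta_settingPrVolSharp_trivial_pos_of_two_le_ramificationIdx X hlog M archPk archSub Ψ act Mmod region n lat sig
    split qData ⟨2, Nat.prime_two⟩ v hv hvp (two_le_absRamificationIdx_rescaledCompletion_two_of_sq_eq_neg_one r hr v hvp)

/-! ## §3. The exact criterion with a positive shift under ONE ramified place -/

/-- **The exact regime criterion with a REAL shift `κ = −|log(Θ)|(𝟙) > 0`** as soon as `F` has one place of ramification
index `≥ 2` (e.g. every base field of genuine Θ-data): for every context there is `κ > 0` with
`Statement(t_q, t) ⟺ Qside − Θside ≤ κ` for all pilot ideles whose bad places lie over a finite set `U` of odd primes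
unramified in `F` (part 12's `statement_settingPrVolSharp_iff_exact`). Part 8's positive half `Qside ≤ Θside ⟹ Statement`
was NOT sharp at such `F` — the unit-box inflation at the ramified packets (not the disputed inference) carries the typed
Statement up to `κ` beyond it. No side taken. [claim: Mochizuki2012, status: disputed] [cite: DupuyHilado2025, §3.6, §3.9, §4.7, §4.9] -/
theorem settingPrVolSharp_regime_exact_pos_of_two_le_ramificationIdx (p₀ : Nat.Primes)
    (v : HeightOneSpectrum (𝓞 F)) (hv : (thetaIndex X).over (.inr v) = .inr p₀) (hvp : ((p₀ : ℕ) : 𝓞 F) ∈ v.asIdeal)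
    (he : haveI : Fact (p₀ : ℕ).Prime := ⟨p₀.2⟩; 2 ≤ absRamificationIdx (p₀ : ℕ) (RescaledCompletion F (p₀ : ℕ) v hvp))
    (U : Finset Nat.Primes)
    (hU : ∀ (pp : Nat.Primes) (x : (thetaIndex X).Fibre (.inr pp)),
      haveI : Fact (pp : ℕ).Prime := ⟨pp.2⟩; placeOf X pp.1 x ∈ X.S → pp ∈ U)
    (hU2 : ∀ pp ∈ U, 2 < (pp : ℕ)) (hUd : ∀ pp ∈ U, ¬ ((pp : ℕ) : ℤ) ∣ NumberField.discr F) :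
    ∃ κ : ℝ, 0 < κ ∧
      (settingPrVolSharp X hlog M archPk archSub Ψ act Mmod region n lat sig split qData (fun _ _ => 1) (fun _ _ _ => 1)
          (fun _ _ => one_ne_zero) (fun _ _ _ => norm_one)).negLogTheta = ((κ : ℝ) : WithTop ℝ) ∧
      ∀ (tq : ∀ (pp : Nat.Primes) (x : (thetaIndex X).Fibre (.inr pp)), haveI : Fact (pp : ℕ).Prime := ⟨pp.2⟩; kOf X pp.1 x)
        (t : ∀ (pp : Nat.Primes) (_ : Fin X.lstar) (x : (thetaIndex X).Fibre (.inr pp)),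
          haveI : Fact (pp : ℕ).Prime := ⟨pp.2⟩; kOf X pp.1 x)
        (ht0 : ∀ pp i x, t pp i x ≠ 0)
        (_ : ∀ (pp : Nat.Primes) (i : Fin X.lstar) (x : (thetaIndex X).Fibre (.inr pp)),
          haveI : Fact (pp : ℕ).Prime := ⟨pp.2⟩; placeOf X pp.1 x ∉ X.S → ‖t pp i x‖ = 1)
        (htq0 : ∀ pp x, tq pp x ≠ 0)
        (htq1 : ∀ (pp : Nat.Primes) (x : (thetaIndex X).Fibre (.inr pp)),
          haveI : Fact (pp : ℕ).Prime := ⟨pp.2⟩; placeOf X pp.1 x ∉ X.S → ‖tq pp x‖ = 1)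
        (m : ∀ pp : Nat.Primes, Fin (thetaIndex X).lstar → (thetaIndex X).Fibre (.inr pp) → ℤ),
        (∀ (pp : Nat.Primes), pp ∈ U → ∀ (i : Fin (thetaIndex X).lstar) (x : (thetaIndex X).Fibre (.inr pp)),
          haveI : Fact (pp : ℕ).Prime := ⟨pp.2⟩; ‖t pp i x‖ = ‖((pp : ℕ) : ℚ_[pp]) ^ m pp i x‖) →
        ∀ (mq : ∀ pp : Nat.Primes, (thetaIndex X).Fibre (.inr pp) → ℤ),
        (∀ (pp : Nat.Primes), pp ∈ U → ∀ (x : (thetaIndex X).Fibre (.inr pp)),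
          haveI : Fact (pp : ℕ).Prime := ⟨pp.2⟩; ‖tq pp x‖ = ‖((pp : ℕ) : ℚ_[pp]) ^ mq pp x‖) →
        ((settingPrVolSharp X hlog M archPk archSub Ψ act Mmod region n lat sig split qData tq t htq0 htq1).Statement ↔
          processionNormalized (fun i : Fin (thetaIndex X).lstar => ∑ pp ∈ U,
              (haveI : Fact (pp : ℕ).Prime := ⟨pp.2⟩;
                ∑ e : (presAt X hlog pp).toLocalPieces.E (Setting.labelSucc i),
                  weightPr X pp.1 (Setting.labelSucc i) e * (-(mq pp (e (Fin.last _))) * Real.log (pp : ℕ)))) -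
            processionNormalized (fun i : Fin (thetaIndex X).lstar => ∑ pp ∈ U,
              (haveI : Fact (pp : ℕ).Prime := ⟨pp.2⟩;
                ∑ e : (presAt X hlog pp).toLocalPieces.E (Setting.labelSucc i),
                  weightPr X pp.1 (Setting.labelSucc i) e *
                    (-(Finset.univ.inf' Finset.univ_nonempty (fun a => m pp i (e a)) * Real.log (pp : ℕ))))) ≤ κ) := by
  have hpos := negLogTheta_settingPrVolSharp_trivial_pos_of_two_le_ramificationIdx X hlog M archPk archSub Ψ act Mmod region
    n lat sig split qData p₀ v hv hvp he
  obtain ⟨κ, hκ⟩ := WithTop.ne_top_iff_exists.mp (negLogTheta_settingPrVolSharp_trivial_ne_top X hlog M archPk archSub Ψ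
    act Mmod region n lat sig split qData)
  refine ⟨κ, ?_, hκ.symm, ?_⟩
  · rw [← hκ] at hpos
    exact WithTop.coe_pos.mp hpos
  intro tq t ht0 ht1 htq0 htq1 m hm mq hmq
  rw [statement_settingPrVolSharp_iff_exact X hlog M archPk archSub Ψ act Mmod region n lat sig split qData t tq ht0 ht1
    htq0 htq1 U hU hU2 hUd m hm mq hmq, ← hκ, WithTop.coe_le_coe]

end Positive

end Real

end Thm311

end IUTFork

end Summit.ABC

end
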